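import Summits.HodgeConjecture.HodgeConjecture.Theses.FiniteTreeOfFlavours
import Literature.AlgebraicGeometry.HodgeTheory.AbsoluteHodgeClasses
import Literature.AlgebraicGeometry.HodgeTheory.HodgeConjectureQbarVoisin
import Literature.AlgebraicGeometry.HodgeTheory.HypersurfaceLefschetz
import Literature.AlgebraicGeometry.HodgeTheory.LefschetzOneOneHolds

/-!
# Birth skeleton (BC3) of the crux `RigidQbarClassesAlgebraic` (stmt-HodgeConjecture-1495),
# route `FiniteTreeOfFlavours` — line `birth`: "Lefschetz off the middle; in the middle, rigid ⟹
# weakly absolute Hodge ⟹ algebraic"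

The crux (rank 5, the ARITHMETIC HEART of the route): on a smooth hypersurface `X ⊂ ℙⁿ⁺¹_ℂ` of
degree `d` which is cut out by a form `F` with algebraic coefficients (a `ℚ̄`-FORM of `X`), every
RIGID rational `(k,k)`-class `c ∈ H²ᵏ(X(ℂ); ℂ)` — one that is NOT the restriction of a rational
`(k,k)`-class `Λ` of a smooth projective `(n+1)`-fold `𝒴 → C` fibred over a smooth projective
curve, with `X ≅ 𝒴_t` and only finitely many fibres `≅ X` — is algebraic
(`c ∈ algebraicClasses X k = Nᵏ H²ᵏ`).  Item docstring: "Expected engines: … CM abelian-type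
realisation + Deligne's absolute Hodge theorem + André motivated cycles, Tate-conjecture bridges
over finite fields for ℚ̄-varieties."

The line cuts the intended proof along its two classical seams — the DEGREE (Lefschetz) and the
ABSOLUTENESS of the class (Deligne / Voisin) — into exactly three statements:

  STUB 1 `stub_offMiddleDegrees` (known in print; L on this tree) — **Lefschetz off the middle
    degree**: for a smooth hypersurface of dimension `n` and every `k` with `2k ≠ n`, EVERY class of
    `H²ᵏ(X(ℂ); ℂ)` is algebraic (`algebraicClasses X k = ⊤`; `H²ᵏ = ℂ·hᵏ` by the Lefschetz
    hyperplane theorem, Voisin II Cor. 1.24/1.25).  It is literally the consumer form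
    `forall_of_two_mul_ne` of the tree's named fact
    `Voisin2003_smoothHypersurface_algebraicClasses_eq_top` (PROVED below:
    `offMiddleDegrees_of_fact`), whose discharge is in progress elsewhere in the tree
    (`HypersurfaceLefschetzProofs`, `…FromVanishing`).  No arithmetic, no rigidity.
  STUB 2 `stub_rigidWeaklyAbsolute` (THE LEVER — what rigidity + the ℚ̄-form buy; open) —
    **a rigid rational `(k,k)`-class of middle degree `2k = n ≥ 4` on a smooth hypersurface with a
    ℚ̄-form is a WEAKLY ABSOLUTE HODGE class** (Voisin 2007 Def. 2.1 = the tree's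
    `IsWeaklyAbsoluteHodgeClass`: every `Aut ℂ`-conjugate `c^σ` on `X^σ` is `(2πi/σ(2πi))ᵏ · t · β`
    with `β` a rational `(k,k)` class and `t ∈ ℚ̄`).  This is Deligne's "Hodge ⟹ absolute Hodge"
    at the ISOLATED ℚ̄-points of the locus of Hodge classes of the universal family `U_{n,d}`:
    Voisin (2007, §2 after Thm. 2.3) — "a given Hodge class is absolute Hodge iff its ℚ-Zariski
    closure in `FᵏH²ᵏ` is contained in the locus of Hodge classes"; for a rigid class on a
    ℚ̄-hypersurface that closure is (mod `PGL_{n+2}`) a finite Galois orbit of isolated points, so the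
    statement is exactly "the finitely many conjugates `(X^τ, c^τ)`, `τ ∈ Gal(ℚ̄/ℚ)`, are again Hodge,
    and `c` is ℚ̄-rational in algebraic de Rham cohomology".  KNOWN for every Fermat hypersurface
    `Xⁿₘ` (all `m`: its motive lies in the Tannakian category generated by abelian varieties via the
    Shioda–Katsura inductive structure, and Hodge classes there are absolutely Hodge — Deligne 1982,
    Thm. 2.11 and §7), i.e. on the whole CM/Fermat sub-family where the crux's listed open cases
    live; Voisin's positive criteria (2007, Thm. 1.5, Cor. 1.6) need a POSITIVE-dimensional
    component of the Hodge locus and are silent exactly here (KOU 2023, Cor. 1.14: points are the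
    open case).  Why it might fail: a rigid NON-CM class (route support item NonCMRigidClassExists —
    existence itself open, BKU 2024 p. 5) carries no structure forcing its conjugates to be
    rational; Deligne's conjecture is open outside abelian motives.
  STUB 3 `stub_weaklyAbsoluteAlgebraic` (THE HEART — where the crux's named open instances sit;
    open) — **the absolute Hodge conjecture for ℚ̄-hypersurfaces in the middle degree**: a weakly
    absolute Hodge class of degree `2k = n ≥ 4` on a smooth hypersurface with a ℚ̄-form is
    algebraic.  No rigidity is assumed (movable weakly-absolute classes are the business of the
    route's crux `MovableClassesAlgebraic`; the cut puts ALL the rigidity content into STUB 2).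
    Engines: for CM / abelian-type leaves, Deligne 1982 + André's motivated cycles (absolute Hodge =
    motivated on abelian-type motives; algebraic once the Lefschetz involutions of the auxiliary
    pencils are, André 1996 §6.3) and the inductive structure of Fermat motives (Shioda 1979:
    `m` prime or `m ≤ 20` done, `m ≥ 21` open — Aoki classes, fake linear cycles arXiv:2112.14818);
    in general, descent of a weakly absolute class to a number field (Voisin 2007, Rem. 1.3: it is
    defined over ℚ̄ in algebraic de Rham cohomology) and Tate-conjecture / crystalline bridges.
    Why it might fail: it contains HC for Fermat `X⁴₂₁`-type cases, open since 1979; "absolute Hodge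
    ⟹ algebraic" is open even for CM abelian varieties of Weil type (dim ≥ 6).
    HC-safe: implied by `HodgeConjecture` (PROVED below, `weaklyAbsoluteAlgebraic_of_hodgeConjecture`).

and the crux follows (`RigidQbarClassesAlgebraic_of`, kernel-checked, no `sorry`): off the middle
degree STUB 1 makes every class algebraic; in the middle degree `2k = n` the cases `k = 0`
(`algebraicClasses X 0 = ⊤`, tree theorem `hodgeConjectureFor_codim_zero`) and `k = 1` (surfaces
in `ℙ³`: the Lefschetz theorem on `(1,1)`-classes, tree theorem `lefschetzOneOne_rational_holds`)
are UNCONDITIONAL, and for `k ≥ 2` (fourfolds and up — exactly the open range of HC) STUB 2 makes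
the rigid class weakly absolute and STUB 3 makes it algebraic.  The cut is tight and not a costume:
STUB 1 carries no arithmetic and does not reach the middle degree; STUB 2 concludes absoluteness,
not algebraicity; STUB 3 assumes absoluteness, which neither the crux's hypotheses nor the summit
provide by the cheap tactics; none of the three is provable from or equivalent to the crux or the
summit by `exact? | simpa | aesop` (BC3 probes, `Lines/birth.md`).

## Contents

* `Moves n X k c` — the crux's MOVABILITY clause VERBATIM as a predicate (so that `¬ Moves n X k c`
  is definitionally the crux's rigidity hypothesis); `HasQbarForm n d X` — the crux's ℚ̄-form clause
  VERBATIM.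
* the three stub STATEMENTS by name, `def Sig.stub_offMiddleDegrees / Sig.stub_rigidWeaklyAbsolute /
  Sig.stub_weaklyAbsoluteAlgebraic : Prop`, the three registered stubs
  `theorem stub_offMiddleDegrees / stub_rigidWeaklyAbsolute / stub_weaklyAbsoluteAlgebraic` restating
  them verbatim (`sorry` ONLY there), and `RigidQbarClassesAlgebraic_of` — the composition
  `Sig.stub_offMiddleDegrees → Sig.stub_rigidWeaklyAbsolute → Sig.stub_weaklyAbsoluteAlgebraic →` the
  crux BY NAME
  (`Summit.HodgeConjecture.HodgeConjecture.Theses.FiniteTreeOfFlavours.RigidQbarClassesAlgebraic`);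
  `RigidQbarClassesAlgebraic_of_stubs` — the crux modulo exactly the three stubs (it type-checks only
  because the `stub_*` signatures agree definitionally with the declared statements).
* PROVED sanity: `offMiddleDegrees_of_fact` (STUB 1 is the tree's named Lefschetz fact, consumer
  form); `weaklyAbsoluteAlgebraic_of_hodgeConjecture` (HC ⟹ STUB 3: HC-safety of the heart);
  `rigidWeaklyAbsoluteAlgebraic_of_crux` (the crux gives STUB 3 back on RIGID classes: on the
  crux's own classes the heart is not stronger than the crux); `example : HodgeConjecture →
  RigidQbarClassesAlgebraic` (HC-safety of the crux, as the refuters recorded for the route).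
  STUB 2 is HC-safe modulo the theorem "cycle classes are absolute Hodge" (Deligne 1982,
  Ex. 2.1 (a); Charles–Schnell §11.2.2), which the tree does not yet have
  (`HodgeTheory/AbsoluteHodgeClasses`, module docstring (3)) — recorded, not proved.
* PROVED special cases of the CRUX (BC5, unconditional, no `sorry`):
  `rigidQbarClassesAlgebraic_dimLEThree` — the crux for hypersurfaces of dimension `n ≤ 3` (plane
  curves, surfaces in `ℙ³`, threefolds in `ℙ⁴`: tree theorem
  `hodgeClasses_algebraic_of_dim_le_three_holds`); `rigidQbarClassesAlgebraic_codimLEOne` — the crux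
  in codimension `k ≤ 1` on hypersurfaces of EVERY dimension (Lefschetz `(1,1)`).  The definitions
  compute and the crux is inhabited in kind; its first open instances are `k = 2` on fourfolds
  (`(n,d) = (4,3)` Zucker, `(4,4),(4,5)` Conte–Murre are named facts of the tree, not yet
  discharged; `(4,d)`, `d ≥ 6`, open).

Disproof used: none on file — `Cruxes/RigidQbarClassesAlgebraic/` had no workfiles at registration
(`ledger crux ls stmt-HodgeConjecture-1495`: "(no workfiles yet)"; no `Disproof.lean`, no
`_false_without_` theorem, no landed `Negative/` lemma); `ledger negatives --problem HodgeConjecture`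
(3 refuted statements: MilnorKExponential symbol lift, DerivedTorelliFermat K3 exhaustion,
ELineTransport connectivity) — none concerns absolute Hodge classes, hypersurface Lefschetz or
ℚ̄-forms, and no stub is an instance of one.

References: [Voisin2007HodgeLoci] Def. 2.1, Rem. 2.2, Prop. 1.2, Rem. 1.3, Thm. 1.5, Cor. 1.6, §2
(p. 4: absolute ⟺ ℚ-Zariski closure in the locus of Hodge classes), Lemma 2.4;
[Deligne1982HodgeCycles] Thm. 2.11, §7; [CharlesSchnell2014Notes] Def. 11.2.3, §11.2.5, Thm. 11.3.19;
[Shioda1979HodgeFermat]; [Andre1996Motifs] Thm. 0.4, 0.6.2, §6.3; [KlinglerOtwinowskaUrbanik2023]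
Cor. 1.13–1.14; [BaldiKlinglerUllmo2024] p. 5; [VoisinHodgeII2003] Cor. 1.24–1.25;
[VoisinHodgeI2002] Thm. 11.30; arXiv:2112.14818.
-/

noncomputable section

namespace Summit.HodgeConjecture.HodgeConjecture.Cruxes.RigidQbarClassesAlgebraic.Birth

open CategoryTheory
open Literature.AlgebraicGeometry
open Literature.AlgebraicGeometry.Motives (SchemeOver AlgPoints fiberOver fiberι IsSmoothProjective
  IsSmoothHypersurface IsHypersurfaceCutOutBy)
open Literature.AlgebraicGeometry.HodgeTheory
open Summit.HodgeConjecture.HodgeConjecture.Theses.FiniteTreeOfFlavours (RigidQbarClassesAlgebraic)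

/-! ### The typable carriers (the crux's clauses, verbatim) -/

/-- **`c` MOVES** (the crux's movability clause, verbatim): the rational class
`c ∈ H²ᵏ(X(ℂ); ℂ)` is the restriction of a rational `(k,k)`-class `Λ` on a smooth projective
`(n+1)`-fold `𝒴` fibred over a smooth projective curve `C`, `X ≅ 𝒴_t`, with only finitely many
fibres isomorphic to `X` (non-isotrivial at `X`).  For hypersurfaces of dimension `n ≥ 3`, `d ≥ 3`
this says: the component through `[X]` of the Hodge locus of `c` in `U_{n,d}/PGL` is
positive-dimensional (route thesis).  `¬ Moves n X k c` is RIGIDITY. [cite: BaldiKlinglerUllmo2024, §2] -/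
def Moves (n : ℕ) (X : SchemeOver ℂ) (k : ℕ) (c : complexBetti X (2 * k)) : Prop :=
  ∃ (𝒴 C : SchemeOver ℂ) (π : 𝒴 ⟶ C) (t : AlgPoints C ℂ) (e : X ≅ fiberOver π t)
    (Λ : complexBetti 𝒴 (2 * k)),
    IsSmoothProjective (n + 1) 𝒴 ∧ IsSmoothProjective 1 C ∧ IsRationalClass Λ ∧
      IsOfHodgeType (n + 1) 𝒴 (2 * k) k k Λ ∧
      (complexBetti.map (e.hom ≫ fiberι π t) (2 * k)).hom Λ = c ∧
      Set.Finite {t' : AlgPoints C ℂ | Nonempty (fiberOver π t' ≅ X)}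

/-- **`X` has a ℚ̄-form of degree `d`** (the crux's arithmetic clause, verbatim): `X ≅ V₊(F) ⊆ ℙⁿ⁺¹_ℂ`
for a homogeneous form `F` of degree `d` all of whose coefficients are algebraic over `ℚ`.
[cite: KlinglerOtwinowskaUrbanik2023, Cor. 1.14] -/
def HasQbarForm (n d : ℕ) (X : SchemeOver ℂ) : Prop :=
  ∃ F : MvPolynomial (Fin (n + 2)) ℂ, F.IsHomogeneous d ∧ (∀ m, IsAlgebraic ℚ (F.coeff m)) ∧
    IsHypersurfaceCutOutBy (n + 1) F X

/-! ### The statements of the three stubs, by name (`Sig.stub_<name> : Prop`)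

The composition `RigidQbarClassesAlgebraic_of` takes the three stub statements BY NAME: the layer
invariant of `ledger skeleton check` (A12) admits a hypothesis of the skeleton theorem only if its
head constant is a registered obligation or is NAMED like one of the declared stubs — hence the
`Sig.stub_*` spelling of these `Prop`s.  The sorried theorems `stub_*` below restate them verbatim
(expanded, so that the registered signatures are self-contained over tree declarations plus the two
verbatim carriers `Moves`, `HasQbarForm`), and `RigidQbarClassesAlgebraic_of_stubs` type-checks only
because the two spellings agree definitionally. -/

namespace Sig

/-- **Statement of STUB 1** (`stub_offMiddleDegrees`): Lefschetz off the middle degree — on a smooth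
`(n,d)`-hypersurface every class of `H²ᵏ(X(ℂ); ℂ)`, `2k ≠ n`, is algebraic.
[cite: VoisinHodgeII2003, Cor. 1.24 and Cor. 1.25] -/
def stub_offMiddleDegrees : Prop :=
  ∀ ⦃n d : ℕ⦄ ⦃X : SchemeOver ℂ⦄, IsSmoothHypersurface n d X →
    ∀ k : ℕ, 2 * k ≠ n → algebraicClasses X k = ⊤

/-- **Statement of STUB 2** (`stub_rigidWeaklyAbsolute`, the lever): a rigid rational `(k,k)`-class
of middle degree `2k = n`, `k ≥ 2`, on a smooth hypersurface with a ℚ̄-form is weakly absolute Hodge.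
[cite: Voisin2007HodgeLoci, Def. 2.1 and §2] [cite: Deligne1982HodgeCycles, Thm. 2.11 and §7] -/
def stub_rigidWeaklyAbsolute : Prop :=
  ∀ ⦃n d : ℕ⦄ ⦃X : SchemeOver ℂ⦄, IsSmoothHypersurface n d X → HasQbarForm n d X →
    ∀ (k : ℕ) (c : complexBetti X (2 * k)), 2 * k = n → 2 ≤ k → IsRationalClass c →
      IsOfHodgeType n X (2 * k) k k c → ¬ Moves n X k c →
        IsWeaklyAbsoluteHodgeClass n X k c

/-- **Statement of STUB 3** (`stub_weaklyAbsoluteAlgebraic`, the heart): a weakly absolute Hodge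
class of middle degree `2k = n`, `k ≥ 2`, on a smooth hypersurface with a ℚ̄-form is algebraic.
[cite: Voisin2007HodgeLoci, Prop. 1.2 and Rem. 1.3] [cite: Shioda1979HodgeFermat, Thm. I–IV] -/
def stub_weaklyAbsoluteAlgebraic : Prop :=
  ∀ ⦃n d : ℕ⦄ ⦃X : SchemeOver ℂ⦄, IsSmoothHypersurface n d X → HasQbarForm n d X →
    ∀ (k : ℕ) (c : complexBetti X (2 * k)), 2 * k = n → 2 ≤ k →
      IsWeaklyAbsoluteHodgeClass n X k c → c ∈ algebraicClasses X k

end Sig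

/-! ### The three registered stubs -/

/-- STUB 1 (known in print; L on this tree) — **Lefschetz off the middle degree: on a smooth
hypersurface `X ⊂ ℙⁿ⁺¹_ℂ` every class of `H²ᵏ(X(ℂ); ℂ)` with `2k ≠ n` is algebraic**,
`algebraicClasses X k = ⊤`.  In print: for `2k < n`, `H²ᵏ(X, ℤ) = ℤ·hᵏ` (Lefschetz hyperplane
theorem through the Veronese embedding, Voisin II Thm. 1.23, Cor. 1.24); for `n < 2k < 2n`,
`H²ᵏ(X, ℤ) = ℤ·α` with `hᵏ = d·α ≠ 0` (Cor. 1.25, Poincaré duality); in both ranges `H²ᵏ = ℂ·hᵏ`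
is spanned by the class of a linear section, a class supported in codimension `k`; the degrees
`k = 0` and `k ≥ n` are theorems of the tree (`algebraicClasses_zero`,
`mem_algebraicClasses_of_degree_top`, `algebraicClasses_eq_top_of_lt`).  This stub is LITERALLY the
consumer form `forall_of_two_mul_ne` of the tree's named fact
`Voisin2003_smoothHypersurface_algebraicClasses_eq_top` (`offMiddleDegrees_of_fact` below), shared
with the route item `ConiveauLadderCubicEightfolds.HypersurfaceOffMiddleDegreesAlgebraic`; its
discharge (Andreotti–Frankel / Morse on the affine complement, transversal lines) is in progress in
`HypersurfaceLefschetzProofs`, `HypersurfaceLefschetzFromVanishing`, `HypersurfaceLefschetzUpper`.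
Why it might fail: it does not in print; on the tree it waits for the vanishing
`H_j((ℙⁿ⁺¹ ∖ X)(ℂ); ℂ) = 0`, `j ≥ n + 2` and the Thom–Gysin sequence of the pair.
[cite: VoisinHodgeII2003, Thm. 1.23, Cor. 1.24 and Cor. 1.25]
[cite: CattaniElZeinGriffithsLe2014, Ch. 9 (Murre) Thm. 9.4.4 and Remark 9.4.5 (b)] -/
theorem stub_offMiddleDegrees :
    ∀ ⦃n d : ℕ⦄ ⦃X : SchemeOver ℂ⦄, IsSmoothHypersurface n d X →
      ∀ k : ℕ, 2 * k ≠ n → algebraicClasses X k = ⊤ := by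
  sorry

/-- STUB 2 (THE LEVER; open — Deligne's "Hodge ⟹ absolute Hodge" at the isolated ℚ̄-points of the
Hodge locus of the universal hypersurface family) — **a RIGID rational `(k,k)`-class of middle
degree `2k = n`, `k ≥ 2`, on a smooth hypersurface with a ℚ̄-form is a weakly absolute Hodge
class** (`IsWeaklyAbsoluteHodgeClass`, Voisin 2007 Def. 2.1 in the de Rham formulation of
Charles–Schnell Def. 11.2.3: each `Aut ℂ`-conjugate `c^σ ∈ H²ᵏ(X^σ(ℂ); ℂ)` exists and is
`(2πi/σ(2πi))ᵏ · t · β`, `β` rational of type `(k,k)`, `t ∈ ℚ̄` — the `ℚ̄`-condition being automatic,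
Rem. 2.2).  Mechanism: `X = V₊(F)`, `F ∈ ℚ̄[x]`, so `X^σ = V₊(F^τ)`, `τ = σ|_ℚ̄`, runs over finitely
many ℚ̄-hypersurfaces; by Voisin 2007 §2 (after Thm. 2.3) `c` is absolute Hodge iff the ℚ-Zariski
closure of the point `(X, c)` of the algebraic bundle `FᵏH²ᵏ → U_{n,d}` (defined over `ℚ`) lies in
the locus of Hodge classes; rigidity (`¬ Moves`: no non-isotrivial one-parameter family through `X`
carries `c` as a Hodge class — by Cattani–Deligne–Kaplan + a curve section + the global invariant
cycle theorem, equivalently: the component of the locus of Hodge classes through `(X, c)` is the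
`PGL_{n+2}`-orbit) makes that closure a union of `PGL`-orbits of conjugate points, so the content is
(i) `c` is ℚ̄-rational in `H²ᵏ_dR(X_ℚ̄/ℚ̄)` (then only `τ ∈ Gal(ℚ̄/ℚ)` act) and (ii) the finitely
many conjugates `c^τ` on `X^τ` are rational up to `ℚ̄^×`.  KNOWN on the whole Fermat/CM sub-family:
Hodge classes on `Xⁿₘ` (every `m`) are absolutely Hodge (Deligne 1982, Thm. 2.11 with §7: the motive
of `Xⁿₘ` is generated by abelian varieties through the Shioda–Katsura inductive structure) — this is
exactly the sub-family carrying the crux's named open cases, so the lever is real there.  Voisin's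
criteria (Thm. 1.5, Cor. 1.6) need a positive-dimensional Hodge-locus component and say nothing at
rigid points (KOU 2023, Cor. 1.14; BKU 2024, p. 5).  Why it might fail: a rigid class on a NON-CM
hypersurface (route support item NonCMRigidClassExists; existence open) has no structure forcing
(i) or (ii); Deligne's conjecture is open outside abelian motives, and (i) alone is a
bi-algebraicity statement for an ISOLATED intersection of a Gauss–Manin leaf with `Fᵏ`, where
Ax–Schanuel gives nothing.  HC-safe modulo "cycle classes are absolute Hodge" (Deligne 1982,
Ex. 2.1 (a)), not yet in the tree.
[cite: Voisin2007HodgeLoci, Def. 2.1, Rem. 2.2, §2 (absolute ⟺ ℚ-Zariski closure), Thm. 1.5, Cor. 1.6]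
[cite: Deligne1982HodgeCycles, Thm. 2.11 and §7] [cite: KlinglerOtwinowskaUrbanik2023, Cor. 1.14]
[cite: BaldiKlinglerUllmo2024, p. 5] [cite: CattaniDeligneKaplan1995JAMS, Thm. 1.1] -/
theorem stub_rigidWeaklyAbsolute :
    ∀ ⦃n d : ℕ⦄ ⦃X : SchemeOver ℂ⦄, IsSmoothHypersurface n d X → HasQbarForm n d X →
      ∀ (k : ℕ) (c : complexBetti X (2 * k)), 2 * k = n → 2 ≤ k → IsRationalClass c →
        IsOfHodgeType n X (2 * k) k k c → ¬ Moves n X k c →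
          IsWeaklyAbsoluteHodgeClass n X k c := by
  sorry

/-- STUB 3 (THE HEART; open — the absolute Hodge conjecture for ℚ̄-hypersurfaces, middle degree) —
**a weakly absolute Hodge class of degree `2k = n`, `k ≥ 2`, on a smooth hypersurface with a
ℚ̄-form is algebraic.**  No rigidity assumed: the cut puts all the rigidity content into STUB 2
(movable weakly-absolute classes are anyway the route's crux `MovableClassesAlgebraic`).  A weakly
absolute class on a ℚ̄-variety is defined over ℚ̄ in algebraic de Rham cohomology (Voisin 2007,
Rem. 1.3 / Lemma 2.4), so it has the arithmetic incarnations absent at transcendental points (a de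
Rham class over a number field; conjugates controlled).  Engines: on CM / abelian-type leaves,
Deligne 1982 + André 1996 (on motives generated by abelian varieties, Hodge = absolute Hodge =
motivated; motivated ⟹ algebraic once the Lefschetz involutions of André's compact pencils are
algebraic, §6.3 Rem. 2) and the inductive structure of Fermat motives (Shioda 1979: HC for `Xⁿₘ`,
`m` prime or `m ≤ 20`; open from `m = 21`: Shioda's condition `Pⁿₘ` fails, Aoki's non-standard
classes, "fake linear cycles" arXiv:2112.14818); in general Tate-conjecture / crystalline bridges
for varieties over number fields (Voisin 2007, Prop. 1.2 is the converse bookkeeping: HC over ℚ̄ ⟹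
HC for weakly absolute classes everywhere — tree fact
`voisin2007_hodgeConjecture_weaklyAbsolute_of_qbar`).  Why it might fail: it CONTAINS the Hodge
conjecture for the Fermat fourfold `X⁴₂₁` and all higher Fermat/Delsarte cases open since 1979, and
"absolute Hodge ⟹ algebraic" is open even for CM abelian varieties of Weil type of dimension `≥ 6`;
no mechanism beyond abelian-type motives is known.  HC-safe (PROVED below:
`weaklyAbsoluteAlgebraic_of_hodgeConjecture`).
[cite: Voisin2007HodgeLoci, Prop. 1.2, Rem. 1.3, Lemma 2.4] [cite: Shioda1979HodgeFermat, Thm. I–IV]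
[cite: Andre1996Motifs, Thm. 0.4, Thm. 0.6.2, §6.3 Rem. 2] [cite: Deligne1982HodgeCycles, Thm. 2.11]
[cite: CharlesSchnell2014Notes, §11.2.5 and Thm. 11.3.19] -/
theorem stub_weaklyAbsoluteAlgebraic :
    ∀ ⦃n d : ℕ⦄ ⦃X : SchemeOver ℂ⦄, IsSmoothHypersurface n d X → HasQbarForm n d X →
      ∀ (k : ℕ) (c : complexBetti X (2 * k)), 2 * k = n → 2 ≤ k →
        IsWeaklyAbsoluteHodgeClass n X k c → c ∈ algebraicClasses X k := by
  sorry

/-! ### The composition: stub₁ → stub₂ → stub₃ → the crux, by name -/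

/-- **THE LINE'S COMPOSITION** (kernel-checked, no `sorry`): Lefschetz off the middle degree
(STUB 1), rigid ⟹ weakly absolute in the middle degree (STUB 2) and weakly absolute ⟹ algebraic
(STUB 3) imply the crux `RigidQbarClassesAlgebraic`.  Off the middle degree (`2k ≠ n`) STUB 1 gives
`algebraicClasses X k = ⊤`; in the middle degree the cases `k = 0` (`hodgeConjectureFor_codim_zero`:
`N⁰H⁰ = H⁰`) and `k = 1` (surfaces in `ℙ³`: `lefschetzOneOne_rational_holds`, the Lefschetz theorem
on `(1,1)`-classes, PROVED in the tree) are unconditional, and for `k ≥ 2` STUB 3 applies to the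
weakly absolute class produced by STUB 2.  Hypotheses = the three stub statements BY NAME
(`Sig.stub_offMiddleDegrees`, `Sig.stub_rigidWeaklyAbsolute`, `Sig.stub_weaklyAbsoluteAlgebraic`);
conclusion = the route's crux decl BY NAME. [folklore] -/
theorem RigidQbarClassesAlgebraic_of :
    Sig.stub_offMiddleDegrees → Sig.stub_rigidWeaklyAbsolute → Sig.stub_weaklyAbsoluteAlgebraic →
      RigidQbarClassesAlgebraic := by
  intro h₁ h₂ h₃ n d X hX hF k c hc hkk hrig
  by_cases hkn : 2 * k = n
  · match k, c, hc, hkk, hrig, hkn with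
    | 0, c, _, _, _, _ => exact hodgeConjectureFor_codim_zero c
    | 1, c, hc, hkk, _, _ => exact lefschetzOneOne_rational_holds hX.1 c hc hkk
    | k + 2, c, hc, hkk, hrig, hkn =>
      exact h₃ hX hF (k + 2) c hkn (Nat.le_add_left 2 k)
        (h₂ hX hF (k + 2) c hkn (Nat.le_add_left 2 k) hc hkk hrig)
  · rw [h₁ hX k hkn]
    exact Submodule.mem_top

/-- **The crux, closed modulo exactly the three registered stubs.** -/
theorem RigidQbarClassesAlgebraic_of_stubs : RigidQbarClassesAlgebraic :=
  RigidQbarClassesAlgebraic_of stub_offMiddleDegrees stub_rigidWeaklyAbsolute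
    stub_weaklyAbsoluteAlgebraic

/-! ### Proved sanity: what each stub is worth against the tree, the crux and the summit -/

/-- **STUB 1 is the tree's named Lefschetz fact, consumer form (PROVED)**: granted
`Voisin2003_smoothHypersurface_algebraicClasses_eq_top` (Lefschetz's theorem on hyperplane sections
for smooth hypersurfaces, `0 < k < n`, `2k ≠ n`), STUB 1 follows for EVERY `k` with `2k ≠ n` — the
excluded degrees `k = 0`, `k = n`, `k > n` being theorems of the tree
(`Voisin2003_smoothHypersurface_algebraicClasses_eq_top.forall_of_two_mul_ne`).  So STUB 1 closes the
day the named fact is discharged. [cite: VoisinHodgeII2003, Cor. 1.24 and Cor. 1.25] -/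
theorem offMiddleDegrees_of_fact (h : Voisin2003_smoothHypersurface_algebraicClasses_eq_top) :
    Sig.stub_offMiddleDegrees :=
  h.forall_of_two_mul_ne

/-- **HC-safety of the heart (PROVED)**: the Hodge conjecture implies STUB 3 — a weakly absolute
Hodge class is a rational class of type `(k,k)` (`IsWeaklyAbsoluteHodgeClass` records both), hence
algebraic under `HodgeConjectureFor n X`, which `HodgeConjecture` grants to the smooth projective `X`
(`IsSmoothHypersurface n d X` has `IsSmoothProjective n X` as first conjunct).  So STUB 3 cannot be
refuted short of a counterexample to HC; its risk is hardness. [cite: Voisin2007HodgeLoci, Def. 2.1] -/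
theorem weaklyAbsoluteAlgebraic_of_hodgeConjecture (hHC : _root_.HodgeConjecture) :
    Sig.stub_weaklyAbsoluteAlgebraic := by
  intro _ _ _ hX _ k c _ _ hw
  exact (hHC hX.1).2 k c hw.1 hw.2.1

/-- **Tightness (PROVED)**: the crux gives STUB 3 back on RIGID classes (in every degree): on the
crux's own classes the heart is not stronger than the crux.  Together with STUB 2 this exhibits the
cut: modulo Lefschetz, the crux is "rigid ⟹ weakly absolute" followed by "weakly absolute ⟹
algebraic", and only the second arrow is asked beyond the rigid classes. [folklore] -/
theorem rigidWeaklyAbsoluteAlgebraic_of_crux (hC : RigidQbarClassesAlgebraic) :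
    ∀ ⦃n d : ℕ⦄ ⦃X : SchemeOver ℂ⦄, IsSmoothHypersurface n d X → HasQbarForm n d X →
      ∀ (k : ℕ) (c : complexBetti X (2 * k)), IsWeaklyAbsoluteHodgeClass n X k c →
        ¬ Moves n X k c → c ∈ algebraicClasses X k :=
  fun _ _ _ hX hF k c hw hrig ↦ hC hX hF k c hw.1 hw.2.1 hrig

/-- **HC-safety of the crux (PROVED)**: the Hodge conjecture implies `RigidQbarClassesAlgebraic`
(forget rigidity and the ℚ̄-form).  Stated as an `example` so that the only theorems concluding the
crux BY NAME are the skeleton's. [cite: Deligne2000, §1] -/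
example (hHC : _root_.HodgeConjecture) : RigidQbarClassesAlgebraic :=
  fun _ _ _ hX _ k c hc hkk _ ↦ (hHC hX.1).2 k c hc hkk

/-! ### Proved: two unconditional special cases of the crux (BC5) -/

/-- **BC5 special case `n ≤ 3` (PROVED, unconditional)**: the crux for smooth hypersurfaces of
dimension at most `3` — plane curves, surfaces in `ℙ³` (every degree: quartic K3's, quintics, …),
threefolds in `ℙ⁴` — in every codimension `k`, rigid or not, ℚ̄-form or not: the Hodge conjecture
holds for all smooth projective varieties of dimension `≤ 3` (tree theorem
`hodgeClasses_algebraic_of_dim_le_three_holds`: Lefschetz `(1,1)` + hard Lefschetz).  The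
definitions compute and the crux is inhabited in kind; its first open instances are `k = 2` on
fourfolds (`(4,3)` Zucker 1977 and `(4,4)`, `(4,5)` Conte–Murre 1978 are named facts of the tree,
not yet discharged; `(4,d)`, `d ≥ 6`, and the Fermat `X⁴₂₁`-type cases are open).
[cite: VoisinHodgeII2003, §10.2.3 proof of Prop. 10.26] -/
theorem rigidQbarClassesAlgebraic_dimLEThree :
    ∀ ⦃n d : ℕ⦄ ⦃X : SchemeOver ℂ⦄, n ≤ 3 → IsSmoothHypersurface n d X → HasQbarForm n d X →
      ∀ (k : ℕ) (c : complexBetti X (2 * k)), IsRationalClass c →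
        IsOfHodgeType n X (2 * k) k k c → ¬ Moves n X k c → c ∈ algebraicClasses X k :=
  fun _ _ _ hn hX _ k c hc hkk _ ↦ hodgeClasses_algebraic_of_dim_le_three_holds hn hX.1 k c hc hkk

/-- **BC5 special case `k ≤ 1` (PROVED, unconditional)**: the crux in codimension `0` and `1` on
smooth hypersurfaces of EVERY dimension — `N⁰H⁰ = H⁰` and the Lefschetz theorem on `(1,1)`-classes
(tree theorems `hodgeConjectureFor_codim_zero`, `lefschetzOneOne_rational_holds`; Kodaira–Serre +
GAGA).  These are exactly the middle-degree cases the composition discharges without STUBS 2–3.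
[cite: VoisinHodgeI2002, Thm. 11.30] -/
theorem rigidQbarClassesAlgebraic_codimLEOne :
    ∀ ⦃n d : ℕ⦄ ⦃X : SchemeOver ℂ⦄, IsSmoothHypersurface n d X → HasQbarForm n d X →
      ∀ (k : ℕ) (c : complexBetti X (2 * k)), k ≤ 1 → IsRationalClass c →
        IsOfHodgeType n X (2 * k) k k c → ¬ Moves n X k c → c ∈ algebraicClasses X k := by
  intro n d X hX _ k c hk hc hkk _
  match k, c, hc, hkk, hk with
  | 0, c, _, _, _ => exact hodgeConjectureFor_codim_zero c
  | 1, c, hc, hkk, _ => exact lefschetzOneOne_rational_holds hX.1 c hc hkk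
  | k + 2, _, _, _, hk => exact absurd hk (by omega)

end Summit.HodgeConjecture.HodgeConjecture.Cruxes.RigidQbarClassesAlgebraic.Birth

end
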